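import Mathlib.Algebra.MvPolynomial.NoZeroDivisors
import Mathlib.RingTheory.Valuation.ExtendToLocalization
import Mathlib.RingTheory.Valuation.ValuationSubring
import Mathlib.RingTheory.Localization.FractionRing
import Literature.RingTheory.MvPolynomial.KaltofenTestDefs
import HarnessLib

/-!
# Kaltofen's Noether forms, degree bound: the degree valuation and auxiliary generic objects
# (definitions)

Definitions used by the proof of the DEGREE part of Kaltofen's Thm. 4 (E. Kaltofen, *Effective
Noether irreducibility forms and applications*, J. Comput. System Sci. 50 (1995) 274–295, §3
Thm. 4: `deg_c Δ ≤ 12d⁶ - 2d⁵ - 10d⁴ + 4d³`) for the forms `genMinor` of `KaltofenTestDefs`: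

* `degValFun`, `degVal` — the total-degree valuation `v(p) = t^{deg p}` on `R[σ]` (`R` a domain),
  `degValK` — its extension to the fraction field (`v(p/q) = t^{deg p - deg q}`); the degree of a
  coefficient polynomial is read off as `deg p ≤ m ⟺ p / c^m ∈ 𝒪_v` (sibling proof files);
* `specQ d t` — the specialisation `ℤ[c] → ℚ`, `c_{0,0} ↦ -1`, `c_{d-1,0} ↦ t`, other `c ↦ 0`
  (it sends `P(x,0)` of the generic polynomial to `x^d - 1`), used to show that the generic
  discriminant and the resultant of the tail do not vanish;
* `tailPoly d = c_{d-1,0} z^{d-1} + … + c_{0,0}` (the tail of `P(z,0)`), `tailRes d` its Sylvester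
  resultant with its derivative (a form of degree `2d - 3`).

Why a valuation (design note): the paper's inductive degree count for `ā_k` (proof of Thm. 1,
(23)) omits the `c`-degree of the cofactor `r(z)` and does not close as printed; the stated bounds
are nevertheless true, and the sibling files prove them by evaluating at the roots of `P(z,0)` in
an algebraic closure of `Frac ℤ[c]` equipped with a valuation ring dominating `degVal`
(one root of degree `1`, `d - 1` roots of degree `0`), then returning to coefficients by Lagrange
interpolation.

## References

* E. Kaltofen, J. Comput. System Sci. 50 (1995) 274–295, §3 Thm. 1, Thm. 4. [Kaltofen1995]
-/

noncomputable section

open Polynomial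

namespace Literature.RingTheory.MvPolynomial.KaltofenAIT

universe u v

section DegVal

open _root_.MvPolynomial

variable {σ : Type*} {R : Type*} [CommRing R]

open scoped Classical in
/-- The value `t^{deg p}` of a nonzero polynomial (and `0` for `0`). [folklore] -/
def degValFun (p : MvPolynomial σ R) : WithZero (Multiplicative ℤ) :=
  if p = 0 then 0 else ((Multiplicative.ofAdd (p.totalDegree : ℤ) : Multiplicative ℤ) :
    WithZero (Multiplicative ℤ))

/-- Value of a nonzero polynomial. [folklore] -/
theorem degValFun_of_ne_zero {p : MvPolynomial σ R} (hp : p ≠ 0) :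
    degValFun p = ((Multiplicative.ofAdd (p.totalDegree : ℤ) : Multiplicative ℤ) :
      WithZero (Multiplicative ℤ)) := by
  rw [degValFun, if_neg hp]

/-- Value of `0`. [folklore] -/
theorem degValFun_zero : degValFun (0 : MvPolynomial σ R) = 0 := by
  rw [degValFun, if_pos rfl]

variable [IsDomain R]

/-- **The (total) degree valuation** on `E = R[σ]` over a domain: `v(p) = t^{deg p}` — large
degree means large value; `deg(pq) = deg p + deg q`, `deg(p + q) ≤ max`. [folklore] -/
def degVal : Valuation (MvPolynomial σ R) (WithZero (Multiplicative ℤ)) where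
  toFun := degValFun
  map_zero' := degValFun_zero
  map_one' := by
    nontriviality R
    rw [degValFun_of_ne_zero one_ne_zero, totalDegree_one]
    rfl
  map_mul' p q := by
    by_cases hp : p = 0
    · rw [hp, zero_mul, degValFun_zero, zero_mul]
    by_cases hq : q = 0
    · rw [hq, mul_zero, degValFun_zero, mul_zero]
    rw [degValFun_of_ne_zero hp, degValFun_of_ne_zero hq, degValFun_of_ne_zero (mul_ne_zero hp hq),
      totalDegree_mul_of_isDomain hp hq, Nat.cast_add, ofAdd_add, WithZero.coe_mul]
  map_add_le_max' p q := by
    by_cases hpq : p + q = 0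
    · rw [hpq, degValFun_zero]; exact zero_le
    by_cases hp : p = 0
    · rw [hp, zero_add, degValFun_zero]; exact le_max_right _ _
    by_cases hq : q = 0
    · rw [hq, add_zero, degValFun_zero]; exact le_max_left _ _
    rw [degValFun_of_ne_zero hpq, degValFun_of_ne_zero hp, degValFun_of_ne_zero hq, le_max_iff,
      WithZero.coe_le_coe, WithZero.coe_le_coe, Multiplicative.ofAdd_le, Multiplicative.ofAdd_le,
      Nat.cast_le, Nat.cast_le, ← le_max_iff]
    exact totalDegree_add p q

/-- Unfolding `degVal`. [folklore] -/
theorem degVal_apply (p : MvPolynomial σ R) : degVal p = degValFun p := rfl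

/-- `v(p) = t^{deg p}` for `p ≠ 0`. [folklore] -/
theorem degVal_of_ne_zero {p : MvPolynomial σ R} (hp : p ≠ 0) :
    degVal p = ((Multiplicative.ofAdd (p.totalDegree : ℤ) : Multiplicative ℤ) :
      WithZero (Multiplicative ℤ)) := degValFun_of_ne_zero hp

/-- `v(p) = 0 ⟺ p = 0`. [folklore] -/
theorem degVal_eq_zero_iff {p : MvPolynomial σ R} : degVal p = 0 ↔ p = 0 := by
  refine ⟨fun h => ?_, fun h => by rw [h, Valuation.map_zero]⟩
  by_contra hp
  rw [degVal_of_ne_zero hp] at h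
  exact WithZero.coe_ne_zero h

/-- Variables have value `t`. [folklore] -/
theorem degVal_X (i : σ) :
    degVal (X i : MvPolynomial σ R) = ((Multiplicative.ofAdd (1 : ℤ) : Multiplicative ℤ) :
      WithZero (Multiplicative ℤ)) := by
  rw [degVal_of_ne_zero (X_ne_zero i), totalDegree_X]
  rfl

/-- `deg p ≤ m ⟺ v(p) ≤ t^m`. [folklore] -/
theorem degVal_le_iff {p : MvPolynomial σ R} {m : ℕ} :
    degVal p ≤ ((Multiplicative.ofAdd (m : ℤ) : Multiplicative ℤ) : WithZero (Multiplicative ℤ)) ↔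
      p.totalDegree ≤ m := by
  by_cases hp : p = 0
  · simp [hp]
  rw [degVal_of_ne_zero hp, WithZero.coe_le_coe, Multiplicative.ofAdd_le, Nat.cast_le]

/-- The support of `degVal` is trivial. [folklore] -/
theorem degVal_supp : (degVal : Valuation (MvPolynomial σ R) _).supp = ⊥ := by
  ext p
  rw [Valuation.mem_supp_iff, degVal_eq_zero_iff, Ideal.mem_bot]

variable (σ R)
variable (K₀ : Type*) [Field K₀] [Algebra (MvPolynomial σ R) K₀] [IsFractionRing (MvPolynomial σ R) K₀]

/-- The degree valuation on the field of rational functions `K₀ = Frac R[σ]`: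
`v(p/q) = t^{deg p - deg q}`. [folklore] -/
def degValK : Valuation K₀ (WithZero (Multiplicative ℤ)) :=
  Valuation.extendToLocalization (degVal : Valuation (MvPolynomial σ R) _)
    (S := nonZeroDivisors (MvPolynomial σ R))
    (fun p hp => by
      rw [Ideal.mem_primeCompl_iff, Valuation.mem_supp_iff, degVal_eq_zero_iff]
      exact nonZeroDivisors.ne_zero hp) K₀

/-- `v_K(p) = v(p)` on polynomials. [folklore] -/
theorem degValK_algebraMap (p : MvPolynomial σ R) :
    degValK σ R K₀ (algebraMap (MvPolynomial σ R) K₀ p) = degVal p :=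
  Valuation.extendToLocalization_apply_map_apply _ _ _ p

/-- **Degree through the valuation ring:** for a polynomial `p` and `c` of degree one,
`deg p ≤ m ⟺ p / c^m ∈ 𝒪_v`. [folklore] -/
theorem totalDegree_le_iff_div_mem (p : MvPolynomial σ R) (i : σ) (m : ℕ) :
    p.totalDegree ≤ m ↔ algebraMap (MvPolynomial σ R) K₀ p / algebraMap (MvPolynomial σ R) K₀ (X i) ^ m ∈
      (degValK σ R K₀).valuationSubring := by
  rw [Valuation.mem_valuationSubring_iff, Valuation.map_div, Valuation.map_pow, degValK_algebraMap,
    degValK_algebraMap, degVal_X, ← degVal_le_iff, ← WithZero.coe_pow, ← ofAdd_nsmul, nsmul_eq_mul, mul_one]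
  have hne : (((Multiplicative.ofAdd (m : ℤ) : Multiplicative ℤ) : WithZero (Multiplicative ℤ))) ≠ 0 :=
    WithZero.coe_ne_zero
  rw [div_le_iff₀ (zero_lt_iff.2 hne), one_mul]

end DegVal

/-! ### Auxiliary generic objects -/

section GenericAux

/-- The specialisation `c_{0,0} ↦ -1`, `c_{d-1,0} ↦ t`, all other `c ↦ 0` into `ℚ`. [folklore] -/
abbrev specQ (d : ℕ) (t : ℚ) : GenCoeff →+* ℚ :=
  MvPolynomial.eval₂Hom (Int.castRingHom ℚ) fun p => if p = (0, 0) then -1 else if p = (d - 1, 0) then t else 0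

/-- The tail `G₂ = c_{d-1,0} z^{d-1} + … + c_{0,0}` of `P(z,0)` of the generic polynomial. [folklore] -/
abbrev tailPoly (d : ℕ) : Polynomial GenCoeff :=
  ∑ e ∈ Finset.range d, Polynomial.C (MvPolynomial.X (e, 0)) * Polynomial.X ^ e

/-- Coefficients of the tail. [folklore] -/
theorem coeff_tailPoly (d n : ℕ) : (tailPoly d).coeff n = if n < d then MvPolynomial.X (n, 0) else 0 := by
  rw [Polynomial.finsetSum_coeff]
  simp only [Polynomial.coeff_C_mul_X_pow]
  rw [Finset.sum_ite_eq]
  simp only [Finset.mem_range]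

/-- The resultant `R₂ = Res^{d-1,d-2}(G₂, G₂')` of the tail. [folklore] -/
abbrev tailRes (d : ℕ) : GenCoeff :=
  Polynomial.resultant (tailPoly d) (Polynomial.derivative (tailPoly d)) (d - 1) (d - 2)

end GenericAux

end Literature.RingTheory.MvPolynomial.KaltofenAIT

end
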